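/-
Copyright (c) 2026 the pub-hodgecm-mathlib formalisation cell (harness21).  Prover seat hodgecm-mathlib-R90-C131-p02 (g0) (R90-TF S4 hand lent to L1
by CHAIR VALVE WORD W4), Track B «K2-LIT», hLiu418 = `stmt-HodgeConjecture-24832`; LEAD F0P6-plan (g14) BATCH #87 (2) (K1a-3-arch), K1-a♮ line lead
K2E5-p16 (g8) WORD #4 (3) «Φ-ROAD: (Φ-S2) `K2LiuHermTwoEtaRankOneReduction` = your file».  THEOREMS ONLY (no `def`, no instance, no notation,
no named-fact hypothesis, no `sorry`); lane `--supports stmt-HodgeConjecture-24832 --as helper`.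
-/
import Summits.HodgeConjecture.HodgeConjecture.Theorems.K2LiuHermTwoEtaConvergenceSemidefinite   -- ★ `integrableOn_etaTwoIntegrand_of_posSemidef`; brings ★ `K2LiuHermTwoEtaDefs` (`etaTwo`, `etaTwoSet_hermTwo`, …), ★ `K2LiuHermTwoGammaDefs` (`hermTwo`, `det_hermTwo`, …)
import Summits.HodgeConjecture.HodgeConjecture.Theorems.K2LiuHermTwoSiegelGindikinFibres          -- ★ `integral_Ioi_comp_add`
import Summits.HodgeConjecture.HodgeConjecture.Theorems.K2LiuArchWhittakerLeviEquivariance      -- ★ `integral_comp_hermTwo_conj` (the Jacobian of `x ↦ a x aᴴ`), `det_conj_eq`, `trace_mul_conj` (ED. 2)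
import Mathlib.Analysis.SpecialFunctions.Gaussian.FourierTransform
import Mathlib.MeasureTheory.Integral.Prod
import HarnessLib

/-!
# Crux `HLiu418`, ROAD Φ — the SINGULAR (rank-one) row of the η-sheet, ED. 1: Shimura's reduction of `η₂(g, h; α, β)` at the rank-one
# semidefinite `h = diag(t, 0)` for DIAGONAL `g = diag(p, q)` — `η₂ = (π/p)·e^{−pt}·Γ(α+β−2)·q^{2−α−β}·∫₀^∞ e^{−pr}(r+2t)^{α−2} r^{β−2} dr`

Cell `hodgecm-mathlib`, crux item hLiu418 = `stmt-HodgeConjecture-24832` (helper lane, count-neutral).  This is brick (Φ-S2) of the KIND 1 a♮ arch row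
(K1a-3-arch): by this seat's census #2 (K2 bus 22:48Z) the archimedean singular big-cell block on the scalar `K_w`-type is Shimura's confluent `ξ₂`
at a RANK-ONE semidefinite `h` (★ `xiTwo_eq_etaTwo_of_posSemidef` turns it into `η₂`), and the one missing analytic input is the continuation of that
`η₂` along `(α, β) = (s+1+k/2+m, s+1−k/2+n)` down to `{0 < re s}` — [Shimura1982, §4 Thm. 4.2] at `n = 2`, `r = 1`.  ED. 1 is the REDUCTION
IDENTITY on the abscissa of absolute convergence; its shape already displays the two arch letters of the line memo (`CENSUS-K1a-GK` §1): the factor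
`Γ(α+β−2) = Γ(2s+m+n)` (the `A₁^∞` pole, on `re s ≤ 0` only) and the residual ONE-variable confluent integral in `r` (the rank-one letter at `s₁`).

THE COMPUTATION (chart `x = hermTwo (a, z, b) = [[a, z],[z̄, b]]`, Lebesgue on `ℝ × ℂ × ℝ`; `g = hermTwo (p, 0, q)`, `h = hermTwo (t, 0, 0)`, `p q t > 0`).
On the domain `{x − h > 0} = {a > t, |z|² < (a − t) b}` (★ `etaTwoSet_eq_of_posSemidef`) the integrand is
`e^{−(pa + qb)} ((a+t)b − |z|²)^{α−2} ((a−t)b − |z|²)^{β−2}`.  Fubini in the order `a` (inner) | `z` | `b` (outer): for `b > 0` the `a`-fibre lives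
on `a > t + |z|²/b`, and the shift `a = t + |z|²/b + r` turns BOTH determinants into products, `det(x−h) = r b`, `det(x+h) = (r+2t) b`, so the
`a`-fibre is `e^{−pt − p|z|²/b − qb} · b^{α+β−4} · J`, `J = ∫₀^∞ e^{−pr}(r+2t)^{α−2} r^{β−2} dr` INDEPENDENT of `(z, b)`; the `z`-fibre is the Gaussian
`∫_ℂ e^{−(p/b)|z|²} dz = π b / p` (Mathlib `GaussianFourier.integral_cexp_neg_mul_sq_norm`, `finrank ℝ ℂ = 2`); the `b`-integral is the Gamma
integral `∫₀^∞ e^{−qb} b^{α+β−3} db = Γ(α+β−2) q^{2−α−β}` (Mathlib `integral_cpow_mul_exp_neg_mul_Ioi`).  Integrability on the product is ★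
`integrableOn_etaTwoIntegrand_of_posSemidef` (`1 < re β`, `3 < re(α+β)`); the iterated integrals are Mathlib `integral_prod_symm` +
`Integrable.integral_prod_right`.
* §1 coordinates: `etaTwoIntegrand_diag_rankOne_apply`, `mem_etaTwoSet_rankOne_iff` (`b > 0`), `indicator_etaTwoSet_rankOne_of_nonpos` (`b ≤ 0`);
* §2 the `a`-fibre `integral_fibre_a_rankOne`; §3 the `z`-fibre `integral_fibre_z_rankOne`; §4 the `b`-integral `integral_fibre_b_rankOne`;
* §5 **`etaTwo_diag_rankOne_eq`** — the reduction identity.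
ED. 2 (next): general positive definite `g` by the unipotent shear fixing `h`; ED. 3: holomorphy of `J` along affine lines and the `(β−1)`-recursion
continuing `Γ(β−1)⁻¹·J` leftwards (the continuation proper).

HONEST LABEL: helper identity on the convergence abscissa; proves no continuation yet; closes no socket.  HC_CM is proved only modulo the 7 printed
citations (2 remaining named inputs: hLiu418 = `stmt-HodgeConjecture-24832`, h413 = `stmt-HodgeConjecture-24833`) until rung 0 closes.  REL ≠ ★ ≠ BUILT.

## References
* [Shimura1982] G. Shimura, *Confluent hypergeometric functions on tube domains*, Math. Ann. 260 (1982), §3 (Case II), §4 Thm. 4.2, (4.10)–(4.12).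
* [Shimura1997] G. Shimura, *Euler Products and Eisenstein Series*, CBMS 93 (1997), §16.4, §18.4–18.5 (singular Fourier coefficients).
-/

set_option autoImplicit false
-- the mandated namespace repeats the single-problem summit's segment (`HodgeConjecture.HodgeConjecture`)
set_option linter.dupNamespace false

noncomputable section

open Complex MeasureTheory Set
open scoped ComplexOrder ComplexConjugate Matrix

namespace Summit.HodgeConjecture.HodgeConjecture.Cruxes.HLiu418.K2LiuHermTwoEtaRankOneReduction

open Summit.HodgeConjecture.HodgeConjecture.Cruxes.HLiu418.K2LiuHermTwoGammaDefs
open Summit.HodgeConjecture.HodgeConjecture.Cruxes.HLiu418.K2LiuHermTwoEtaDefs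
open Summit.HodgeConjecture.HodgeConjecture.Cruxes.HLiu418.K2LiuHermTwoEtaConvergenceSemidefinite
open Summit.HodgeConjecture.HodgeConjecture.Cruxes.HLiu418.K2LiuHermTwoSiegelGindikinFibres (integral_Ioi_comp_add)
open Summit.HodgeConjecture.HodgeConjecture.Cruxes.HLiu418.K2LiuArchWhittakerLeviEquivariance (integral_comp_hermTwo_conj det_conj_eq trace_mul_conj)

/-! ## §1 The integrand and the domain in coordinates -/

/-- The rank-one profile `h = diag(t, 0)` is positive semidefinite for `t ≥ 0`. [Shimura1982, §4] -/
theorem posSemidef_hermTwo_rankOne {t : ℝ} (ht : 0 ≤ t) : (hermTwo (t, 0, 0)).PosSemidef := by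
  have h : hermTwo (t, 0, 0) = Matrix.diagonal ![(t : ℂ), 0] := by
    ext i j
    fin_cases i <;> fin_cases j <;> simp [hermTwo]
  rw [h, Matrix.posSemidef_diagonal_iff]
  intro i
  fin_cases i
  · exact Complex.zero_le_real.mpr ht
  · simp

/-- The diagonal `g = diag(p, q)` is positive definite for `p, q > 0`. [Shimura1982, §4] -/
theorem posDef_hermTwo_diag {p q : ℝ} (hp : 0 < p) (hq : 0 < q) : (hermTwo (p, 0, q)).PosDef := by
  rw [posDef_hermTwo_iff]
  refine ⟨hp, ?_⟩
  simp only [map_zero]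
  exact mul_pos hp hq

/-- **The integrand of `η₂(diag(p,q), diag(t,0); α, β)` in coordinates**: at `x = hermTwo (a, z, b)`,
`e^{−(pa + qb)} ((a+t)b − |z|²)^{α−2} ((a−t)b − |z|²)^{β−2}`. [Shimura1982, §4 (4.10)] -/
theorem etaTwoIntegrand_diag_rankOne_apply (p q t : ℝ) (α β : ℂ) (c : ℝ × ℂ × ℝ) :
    etaTwoIntegrand (hermTwo (p, 0, q)) (hermTwo (t, 0, 0)) α β c =
      cexp (-((c.1 * p + c.2.2 * q : ℝ) : ℂ)) *
        ((((c.1 + t) * c.2.2 - normSq c.2.1 : ℝ) : ℂ) ^ (α - 2) * (((c.1 - t) * c.2.2 - normSq c.2.1 : ℝ) : ℂ) ^ (β - 2)) := by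
  rw [etaTwoIntegrand_apply, ← hermTwo_add, ← hermTwo_sub, det_hermTwo, det_hermTwo, trace_hermTwo_mul_hermTwo]
  simp only [Prod.fst_add, Prod.snd_add, Prod.fst_sub, Prod.snd_sub, add_zero, sub_zero, map_zero, mul_zero,
    Complex.zero_re]

/-- **The domain in coordinates over `b > 0`**: `x = hermTwo (a, z, b)` satisfies `x ± diag(t,0) > 0` (`t > 0`) iff `a > t + |z|²/b`.
[Shimura1982, §4] -/
theorem mem_etaTwoSet_rankOne_iff {t : ℝ} (ht : 0 < t) {a : ℝ} {z : ℂ} {b : ℝ} (hb : 0 < b) :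
    (a, z, b) ∈ etaTwoSet (hermTwo (t, 0, 0)) ↔ t + normSq z / b < a := by
  rw [etaTwoSet_hermTwo]
  simp only [mem_inter_iff, mem_setOf_eq, add_zero, sub_zero]
  constructor
  · rintro ⟨-, h2, h3⟩
    have : normSq z / b < a - t := by rw [div_lt_iff₀ hb]; linarith [h3]
    linarith
  · intro h
    have hat : 0 < a - t := by
      have : 0 ≤ normSq z / b := div_nonneg (normSq_nonneg z) hb.le
      linarith
    have h3 : normSq z < (a - t) * b := by
      have : normSq z / b < a - t := by linarith
      rwa [div_lt_iff₀ hb] at this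
    refine ⟨⟨by linarith, ?_⟩, hat, h3⟩
    have : (a - t) * b ≤ (a + t) * b := by nlinarith
    linarith

/-- Over `b ≤ 0` the domain is EMPTY in the `a`-direction: the truncated integrand vanishes. [Shimura1982, §4] -/
theorem indicator_etaTwoSet_rankOne_of_nonpos {t : ℝ} (F : ℝ × ℂ × ℝ → ℂ) {a : ℝ} {z : ℂ} {b : ℝ} (hb : b ≤ 0) :
    (etaTwoSet (hermTwo (t, 0, 0))).indicator F (a, z, b) = 0 := by
  refine indicator_of_notMem ?_ _
  rw [etaTwoSet_hermTwo]
  simp only [mem_inter_iff, mem_setOf_eq, add_zero, sub_zero, not_and]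
  intro _ hat hlt
  have : (a - t) * b ≤ 0 := mul_nonpos_of_nonneg_of_nonpos hat.le hb
  have := normSq_nonneg z
  linarith

/-! ## §2 The `a`-fibre (inner): the shift `a = t + |z|²/b + r` -/

/-- **The `a`-fibre**: for `b > 0`, `∫_a 1_{x±h>0} e^{−(pa+qb)} det(x+h)^{α−2} det(x−h)^{β−2} da = e^{−(pt + p|z|²/b + qb)} · b^{α−2} b^{β−2} · J`,
`J = ∫₀^∞ e^{−pr} (r+2t)^{α−2} r^{β−2} dr` (after `a = t + |z|²/b + r`: `det(x−h) = r b`, `det(x+h) = (r+2t) b`). [Shimura1982, §4 (4.10)–(4.11)] -/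
theorem integral_fibre_a_rankOne {p q t : ℝ} (ht : 0 < t) (α β : ℂ) (z : ℂ) {b : ℝ} (hb : 0 < b) :
    ∫ a : ℝ, (etaTwoSet (hermTwo (t, 0, 0))).indicator (etaTwoIntegrand (hermTwo (p, 0, q)) (hermTwo (t, 0, 0)) α β) (a, z, b) =
      cexp (-((p * t + p * (normSq z / b) + q * b : ℝ) : ℂ)) * ((b : ℂ) ^ (α - 2) * (b : ℂ) ^ (β - 2)) *
        ∫ r in Ioi (0 : ℝ), cexp (-((p * r : ℝ) : ℂ)) * (((r + 2 * t : ℝ) : ℂ) ^ (α - 2) * ((r : ℝ) : ℂ) ^ (β - 2)) := by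
  set S := etaTwoSet (hermTwo (t, 0, 0)) with hS
  set I := etaTwoIntegrand (hermTwo (p, 0, q)) (hermTwo (t, 0, 0)) α β with hI
  have h1 : (fun a : ℝ => S.indicator I (a, z, b)) = (Ioi (t + normSq z / b)).indicator (fun a => I (a, z, b)) := by
    funext a
    by_cases ha : t + normSq z / b < a
    · rw [indicator_of_mem ((mem_etaTwoSet_rankOne_iff ht hb).2 ha), indicator_of_mem (show a ∈ Ioi _ from ha)]
    · rw [indicator_of_notMem (fun h => ha ((mem_etaTwoSet_rankOne_iff ht hb).1 h)),
        indicator_of_notMem (show a ∉ Ioi _ from ha)]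
  rw [h1, integral_indicator measurableSet_Ioi, ← integral_Ioi_comp_add]
  have h2 : EqOn (fun r : ℝ => I (r + (t + normSq z / b), z, b))
      (fun r : ℝ => cexp (-((p * t + p * (normSq z / b) + q * b : ℝ) : ℂ)) * ((b : ℂ) ^ (α - 2) * (b : ℂ) ^ (β - 2)) *
        (cexp (-((p * r : ℝ) : ℂ)) * (((r + 2 * t : ℝ) : ℂ) ^ (α - 2) * ((r : ℝ) : ℂ) ^ (β - 2)))) (Ioi 0) := by
    intro r hr
    have hr' : 0 ≤ r := le_of_lt hr
    simp only [hI, etaTwoIntegrand_diag_rankOne_apply]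
    have hb0 : b ≠ 0 := hb.ne'
    have hdet1 : (r + (t + normSq z / b) + t) * b - normSq z = (r + 2 * t) * b := by
      field_simp
      ring
    have hdet2 : (r + (t + normSq z / b) - t) * b - normSq z = r * b := by
      field_simp
      ring
    have htr : (((r + (t + normSq z / b)) * p + b * q : ℝ) : ℂ) =
        ((p * t + p * (normSq z / b) + q * b : ℝ) : ℂ) + ((p * r : ℝ) : ℂ) := by
      push_cast
      ring
    rw [hdet1, hdet2, htr, neg_add, Complex.exp_add, Complex.ofReal_mul (r + 2 * t) b, Complex.ofReal_mul r b,
      mul_cpow_ofReal_nonneg (show (0 : ℝ) ≤ r + 2 * t by linarith) hb.le (α - 2), mul_cpow_ofReal_nonneg hr' hb.le (β - 2)]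
    push_cast
    ring
  rw [setIntegral_congr_fun measurableSet_Ioi h2, integral_const_mul]

/-! ## §3 The `z`-fibre: a Gaussian on `ℂ ≅ ℝ²` -/

/-- **The `z`-fibre**: for `b > 0`, `∫_ℂ e^{−(pt + p|z|²/b + qb)} dz = (π b / p) · e^{−(pt + qb)}` (`finrank ℝ ℂ = 2`). [Shimura1982, §4 (4.11)] -/
theorem integral_fibre_z_rankOne {p : ℝ} (hp : 0 < p) (q t : ℝ) {b : ℝ} (hb : 0 < b) (C : ℂ) :
    ∫ z : ℂ, cexp (-((p * t + p * (normSq z / b) + q * b : ℝ) : ℂ)) * C =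
      ((Real.pi * b / p : ℝ) : ℂ) * cexp (-((p * t + q * b : ℝ) : ℂ)) * C := by
  have hpb : 0 < ((p / b : ℝ) : ℂ).re := by rw [ofReal_re]; exact div_pos hp hb
  have hpt : ∀ z : ℂ, cexp (-((p * t + p * (normSq z / b) + q * b : ℝ) : ℂ)) * C =
      (cexp (-((p * t + q * b : ℝ) : ℂ)) * C) * cexp (-((p / b : ℝ) : ℂ) * (‖z‖ : ℂ) ^ 2) := by
    intro z
    rw [Complex.normSq_eq_norm_sq]
    have : cexp (-((p * t + p * (‖z‖ ^ 2 / b) + q * b : ℝ) : ℂ)) =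
        cexp (-((p * t + q * b : ℝ) : ℂ)) * cexp (-((p / b : ℝ) : ℂ) * (‖z‖ : ℂ) ^ 2) := by
      rw [← Complex.exp_add]
      congr 1
      push_cast
      ring
    rw [this]
    ring
  simp_rw [hpt]
  rw [integral_const_mul, GaussianFourier.integral_cexp_neg_mul_sq_norm hpb]
  have h22 : ((Module.finrank ℝ ℂ : ℂ) / 2) = 1 := by
    rw [Complex.finrank_real_complex]
    norm_num
  rw [h22, cpow_one]
  have hb0 : (b : ℂ) ≠ 0 := ofReal_ne_zero.mpr hb.ne'
  have hp0 : (p : ℂ) ≠ 0 := ofReal_ne_zero.mpr hp.ne'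
  push_cast
  field_simp

/-! ## §4 The `b`-integral: a Gamma integral -/

/-- **The `b`-integral**: `∫₀^∞ (π b/p) e^{−(pt+qb)} b^{α−2} b^{β−2} db · J = (π/p) e^{−pt} Γ(α+β−2) q^{2−α−β} · J` (`re(α+β) > 2`).
[Shimura1982, §4 (4.12)] -/
theorem integral_fibre_b_rankOne {p q : ℝ} (hq : 0 < q) (t : ℝ) {α β : ℂ} (hαβ : 2 < (α + β).re) (J : ℂ) :
    ∫ b in Ioi (0 : ℝ), ((Real.pi * b / p : ℝ) : ℂ) * cexp (-((p * t + q * b : ℝ) : ℂ)) * ((b : ℂ) ^ (α - 2) * (b : ℂ) ^ (β - 2)) * J =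
      (Real.pi : ℂ) / p * cexp (-((p * t : ℝ) : ℂ)) * ((1 / (q : ℂ)) ^ (α + β - 2) * Complex.Gamma (α + β - 2)) * J := by
  have h2 : EqOn (fun b : ℝ => ((Real.pi * b / p : ℝ) : ℂ) * cexp (-((p * t + q * b : ℝ) : ℂ)) * ((b : ℂ) ^ (α - 2) * (b : ℂ) ^ (β - 2)) * J)
      (fun b : ℝ => ((Real.pi : ℂ) / p * cexp (-((p * t : ℝ) : ℂ)) * J) * ((b : ℂ) ^ (α + β - 2 - 1) * cexp (-(q * b)))) (Ioi 0) := by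
    intro b hb
    have hb0 : (b : ℂ) ≠ 0 := ofReal_ne_zero.mpr (ne_of_gt hb)
    have hpow : (b : ℂ) * ((b : ℂ) ^ (α - 2) * (b : ℂ) ^ (β - 2)) = (b : ℂ) ^ (α + β - 2 - 1) := by
      rw [← cpow_add _ _ hb0, show α + β - 2 - 1 = (α - 2 + (β - 2)) + 1 by ring, cpow_add (α - 2 + (β - 2)) 1 hb0, cpow_one]
      ring
    have hexp : cexp (-((p * t + q * b : ℝ) : ℂ)) = cexp (-((p * t : ℝ) : ℂ)) * cexp (-(q * b)) := by
      rw [← Complex.exp_add]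
      congr 1
      push_cast
      ring
    simp only
    rw [hexp, ← hpow]
    push_cast
    ring
  rw [setIntegral_congr_fun measurableSet_Ioi h2, integral_const_mul,
    integral_cpow_mul_exp_neg_mul_Ioi (by have h := hαβ; rw [add_re] at h; rw [sub_re, add_re]; norm_num; linarith) hq]
  ring

/-! ## §5 The reduction identity -/

/-- **SHIMURA'S RANK-ONE REDUCTION of `η₂` (diagonal `g`), [Shimura1982, §4 Thm. 4.2] at `n = 2`, `r = 1`.**  For `p q t > 0` and
`1 < re β`, `3 < re(α + β)`:
`η₂(diag(p,q), diag(t,0); α, β) = (π/p) · e^{−pt} · q^{−(α+β−2)} Γ(α+β−2) · ∫₀^∞ e^{−pr} (r+2t)^{α−2} r^{β−2} dr`.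
The factor `Γ(α+β−2)` is the archimedean `A₁`-letter (pole only on `re(α+β) ≤ 2`, i.e. `re s ≤ 0` along the K1 lines); the `r`-integral is the
one-variable confluent letter (the rank-one archimedean Whittaker family at the shifted parameter). [Shimura1982, §4 Thm. 4.2, (4.10)–(4.12)]
[Shimura1997, §18.4] -/
theorem etaTwo_diag_rankOne_eq {p q t : ℝ} (hp : 0 < p) (hq : 0 < q) (ht : 0 < t) {α β : ℂ} (hβ : 1 < β.re) (hαβ : 3 < (α + β).re) :
    etaTwo (hermTwo (p, 0, q)) (hermTwo (t, 0, 0)) α β =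
      (Real.pi : ℂ) / p * cexp (-((p * t : ℝ) : ℂ)) * ((1 / (q : ℂ)) ^ (α + β - 2) * Complex.Gamma (α + β - 2)) *
        ∫ r in Ioi (0 : ℝ), cexp (-((p * r : ℝ) : ℂ)) * (((r + 2 * t : ℝ) : ℂ) ^ (α - 2) * ((r : ℝ) : ℂ) ^ (β - 2)) := by
  set S := etaTwoSet (hermTwo (t, 0, 0)) with hS
  set I := etaTwoIntegrand (hermTwo (p, 0, q)) (hermTwo (t, 0, 0)) α β with hI
  set J := ∫ r in Ioi (0 : ℝ), cexp (-((p * r : ℝ) : ℂ)) * (((r + 2 * t : ℝ) : ℂ) ^ (α - 2) * ((r : ℝ) : ℂ) ^ (β - 2)) with hJ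
  -- integrability of the truncated integrand on `ℝ × (ℂ × ℝ)`
  have hSm : MeasurableSet S := measurableSet_etaTwoSet (isHermitian_hermTwo _)
  have hint : Integrable (S.indicator I) ((volume : Measure ℝ).prod (volume : Measure (ℂ × ℝ))) := by
    rw [← Measure.volume_eq_prod, integrable_indicator_iff hSm]
    exact integrableOn_etaTwoIntegrand_of_posSemidef (posDef_hermTwo_diag hp hq) (posSemidef_hermTwo_rankOne ht.le) hβ hαβ
  -- the `a`-fibres, as a function of `(z, b)`
  have hfib : (fun zb : ℂ × ℝ => ∫ a : ℝ, S.indicator I (a, zb)) =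
      fun zb : ℂ × ℝ => (Ioi (0 : ℝ)).indicator
        (fun b => cexp (-((p * t + p * (normSq zb.1 / b) + q * b : ℝ) : ℂ)) * ((b : ℂ) ^ (α - 2) * (b : ℂ) ^ (β - 2)) * J) zb.2 := by
    funext zb
    rcases zb with ⟨z, b⟩
    by_cases hb : 0 < b
    · rw [indicator_of_mem (show b ∈ Ioi (0 : ℝ) from hb)]
      exact integral_fibre_a_rankOne ht α β z hb
    · rw [indicator_of_notMem (show b ∉ Ioi (0 : ℝ) from hb)]
      have h0 : (fun a : ℝ => S.indicator I (a, (z, b))) = fun _ => 0 :=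
        funext fun a => indicator_etaTwoSet_rankOne_of_nonpos I (le_of_not_gt hb)
      rw [h0, integral_zero]
  -- Fubini: inner `a`, outer `(z, b)`
  rw [etaTwo_def, ← integral_indicator hSm, Measure.volume_eq_prod, integral_prod_symm _ hint]
  have hint2 : Integrable (fun zb : ℂ × ℝ => ∫ a : ℝ, S.indicator I (a, zb)) (volume : Measure (ℂ × ℝ)) :=
    hint.integral_prod_right
  rw [hfib] at hint2 ⊢
  rw [Measure.volume_eq_prod] at hint2
  -- Fubini again: inner `z`, outer `b`
  rw [Measure.volume_eq_prod, integral_prod_symm _ hint2]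
  have hz : ∀ b : ℝ, (∫ z : ℂ, (Ioi (0 : ℝ)).indicator
        (fun b => cexp (-((p * t + p * (normSq z / b) + q * b : ℝ) : ℂ)) * ((b : ℂ) ^ (α - 2) * (b : ℂ) ^ (β - 2)) * J) b) =
      (Ioi (0 : ℝ)).indicator (fun b => ((Real.pi * b / p : ℝ) : ℂ) * cexp (-((p * t + q * b : ℝ) : ℂ)) *
        ((b : ℂ) ^ (α - 2) * (b : ℂ) ^ (β - 2)) * J) b := by
    intro b
    by_cases hb : 0 < b
    · simp only [indicator_of_mem (show b ∈ Ioi (0 : ℝ) from hb)]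
      have h := integral_fibre_z_rankOne hp q t hb (((b : ℂ) ^ (α - 2) * (b : ℂ) ^ (β - 2)) * J)
      simp only [← mul_assoc] at h ⊢
      rw [h]
    · simp only [indicator_of_notMem (show b ∉ Ioi (0 : ℝ) from hb), integral_zero]
  have hz' : (fun b : ℝ => ∫ z : ℂ, (fun zb : ℂ × ℝ => (Ioi (0 : ℝ)).indicator
        (fun b => cexp (-((p * t + p * (normSq zb.1 / b) + q * b : ℝ) : ℂ)) * ((b : ℂ) ^ (α - 2) * (b : ℂ) ^ (β - 2)) * J) zb.2) (z, b)) =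
      (Ioi (0 : ℝ)).indicator fun b => ((Real.pi * b / p : ℝ) : ℂ) * cexp (-((p * t + q * b : ℝ) : ℂ)) *
        ((b : ℂ) ^ (α - 2) * (b : ℂ) ^ (β - 2)) * J := by
    funext b
    exact hz b
  rw [hz', integral_indicator measurableSet_Ioi, integral_fibre_b_rankOne hq t (by linarith) J]

/-! ## §6 (ED. 2) General positive definite `g`: the `h`-fixing unipotent shear reduces to diagonal `g`

For `h = diag(t, 0)` the upper unipotent `m = (1 κ; 0 1)` FIXES `h` (`m h mᴴ = h`) and has `det m = 1`, so the substitution `x ↦ m x mᴴ`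
(★ `integral_comp_hermTwo_conj`, Jacobian `‖det m‖⁴ = 1`) gives `η(g, h) = η(mᴴ g m, h)` for every `g`; with `κ = −g₀₁/g₀₀` the matrix
`mᴴ g m = diag(g₀₀, det g / g₀₀)` is DIAGONAL, and §5 applies. [Shimura1982, §4 (4.3)–(4.5)] -/

/-- the shear `m = (1 κ; 0 1)` has determinant `1`. [folklore] -/
theorem det_shear (κ : ℂ) : (!![(1 : ℂ), κ; 0, 1] : Matrix (Fin 2) (Fin 2) ℂ).det = 1 := by
  rw [Matrix.det_fin_two_of]; ring

/-- the shear FIXES the rank-one profile: `m · diag(t,0) · mᴴ = diag(t,0)`. [Shimura1982, §4] -/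
theorem shear_mul_rankOne_mul_conjTranspose (κ : ℂ) (t : ℝ) :
    (!![(1 : ℂ), κ; 0, 1] : Matrix (Fin 2) (Fin 2) ℂ) * hermTwo (t, 0, 0) * (!![(1 : ℂ), κ; 0, 1] : Matrix (Fin 2) (Fin 2) ℂ)ᴴ = hermTwo (t, 0, 0) := by
  ext i j
  fin_cases i <;> fin_cases j <;>
    simp [hermTwo, Matrix.mul_apply, Fin.sum_univ_two, Matrix.conjTranspose_apply]

/-- the shear DIAGONALISES a hermitian `g = hermTwo (p, w, q)` with `p ≠ 0` at `κ = −w/p`: `mᴴ g m = diag(p, q − |w|²/p)`. [Shimura1982, §4] -/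
theorem conjTranspose_shear_mul_mul (p q : ℝ) (w : ℂ) (hp : p ≠ 0) :
    (!![(1 : ℂ), -w / p; 0, 1] : Matrix (Fin 2) (Fin 2) ℂ)ᴴ * hermTwo (p, w, q) * (!![(1 : ℂ), -w / p; 0, 1] : Matrix (Fin 2) (Fin 2) ℂ) =
      hermTwo (p, 0, q - normSq w / p) := by
  have hp' : (p : ℂ) ≠ 0 := ofReal_ne_zero.mpr hp
  ext i j
  fin_cases i <;> fin_cases j
  · simp [hermTwo, Matrix.mul_apply, Fin.sum_univ_two, Matrix.conjTranspose_apply]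
  · simp [hermTwo, Matrix.mul_apply, Fin.sum_univ_two, Matrix.conjTranspose_apply]
    field_simp
    ring
  · simp [hermTwo, Matrix.mul_apply, Fin.sum_univ_two, Matrix.conjTranspose_apply, Complex.conj_ofReal]
    field_simp
    ring
  · simp [hermTwo, Matrix.mul_apply, Fin.sum_univ_two, Matrix.conjTranspose_apply, Complex.conj_ofReal]
    rw [Complex.normSq_eq_conj_mul_self]
    field_simp
    ring

/-- **`η` is invariant under an `h`-FIXING unimodular congruence**: if `a h aᴴ = h` and `‖det a‖ = 1` then `η(g, h; α, β) = η(aᴴ g a, h; α, β)`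
for every `g` (substitution `x ↦ a x aᴴ`: Jacobian `‖det a‖⁴ = 1` ★ `integral_comp_hermTwo_conj`; `a(x ± h)aᴴ = a x aᴴ ± h`, positive definiteness is
congruence-invariant, `det(a y aᴴ) = det y` ★ `det_conj_eq`, `tr(g · a x aᴴ) = tr(aᴴ g a · x)` ★ `trace_mul_conj`). [Shimura1982, §4 (4.3)] -/
theorem etaTwo_eq_of_conj_fix {a h : Matrix (Fin 2) (Fin 2) ℂ} (hh : h.IsHermitian) (hdet : ‖a.det‖ = 1) (hfix : a * h * aᴴ = h)
    (g : Matrix (Fin 2) (Fin 2) ℂ) (α β : ℂ) :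
    etaTwo g h α β = etaTwo (aᴴ * g * a) h α β := by
  have ha : a.det ≠ 0 := fun h0 => by rw [h0, norm_zero] at hdet; exact zero_ne_one hdet
  have haU : IsUnit a := (Matrix.isUnit_iff_isUnit_det a).mpr (Ne.isUnit ha)
  -- the integrand as a function of the MATRIX
  set G : Matrix (Fin 2) (Fin 2) ℂ → Matrix (Fin 2) (Fin 2) ℂ → ℂ := fun g' x =>
    {x : Matrix (Fin 2) (Fin 2) ℂ | (x + h).PosDef ∧ (x - h).PosDef}.indicator
      (fun x => cexp (-(x * g').trace) * ((x + h).det ^ (α - 2) * (x - h).det ^ (β - 2))) x with hG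
  have hGc : ∀ (g' : Matrix (Fin 2) (Fin 2) ℂ) (c : ℝ × ℂ × ℝ), (etaTwoSet h).indicator (etaTwoIntegrand g' h α β) c = G g' (hermTwo c) := by
    intro g' c
    by_cases hc : c ∈ etaTwoSet h
    · simp only [hG]
      rw [indicator_of_mem hc, indicator_of_mem (show hermTwo c ∈ {x : Matrix (Fin 2) (Fin 2) ℂ | (x + h).PosDef ∧ (x - h).PosDef} from hc),
        etaTwoIntegrand_apply]
    · simp only [hG]
      rw [indicator_of_notMem hc, indicator_of_notMem (show hermTwo c ∉ {x : Matrix (Fin 2) (Fin 2) ℂ | (x + h).PosDef ∧ (x - h).PosDef} from hc)]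
  -- the integrand transforms: `G g (a x aᴴ) = G (aᴴ g a) x`
  have hconj : ∀ x : Matrix (Fin 2) (Fin 2) ℂ, G g (a * x * aᴴ) = G (aᴴ * g * a) x := by
    intro x
    have hadd : a * x * aᴴ + h = a * (x + h) * aᴴ := by rw [Matrix.mul_add, Matrix.add_mul, hfix]
    have hsub : a * x * aᴴ - h = a * (x - h) * aᴴ := by rw [Matrix.mul_sub, Matrix.sub_mul, hfix]
    have hpd : ∀ y : Matrix (Fin 2) (Fin 2) ℂ, (a * y * aᴴ).PosDef ↔ y.PosDef := fun y => by
      rw [← Matrix.star_eq_conjTranspose]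
      exact Matrix.IsUnit.posDef_star_right_conjugate_iff haU
    have hdet' : ∀ y : Matrix (Fin 2) (Fin 2) ℂ, (a * y * aᴴ).det = y.det := fun y => by
      rw [det_conj_eq, hdet, one_pow, ofReal_one, one_mul]
    have htr : (a * x * aᴴ * g).trace = (x * (aᴴ * g * a)).trace := by
      rw [Matrix.trace_mul_comm, trace_mul_conj, Matrix.trace_mul_comm]
    by_cases hx : x ∈ {x : Matrix (Fin 2) (Fin 2) ℂ | (x + h).PosDef ∧ (x - h).PosDef}
    · have hx' : a * x * aᴴ ∈ {x : Matrix (Fin 2) (Fin 2) ℂ | (x + h).PosDef ∧ (x - h).PosDef} := by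
        simp only [mem_setOf_eq] at hx ⊢
        rw [hadd, hsub, hpd, hpd]
        exact hx
      simp only [hG]
      rw [indicator_of_mem hx', indicator_of_mem hx, hadd, hsub, hdet', hdet', htr]
    · have hx' : a * x * aᴴ ∉ {x : Matrix (Fin 2) (Fin 2) ℂ | (x + h).PosDef ∧ (x - h).PosDef} := by
        simp only [mem_setOf_eq] at hx ⊢
        rw [hadd, hsub, hpd, hpd]
        exact hx
      simp only [hG]
      rw [indicator_of_notMem hx', indicator_of_notMem hx]
  -- assemble
  have hSm : MeasurableSet (etaTwoSet h) := measurableSet_etaTwoSet hh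
  rw [etaTwo_def, etaTwo_def, ← integral_indicator hSm, ← integral_indicator hSm]
  simp_rw [hGc]
  rw [integral_comp_hermTwo_conj ha (G g), hdet, one_pow, one_smul]
  simp_rw [hconj]

/-- **SHIMURA'S RANK-ONE REDUCTION of `η₂` for a GENERAL positive definite `g`** ([Shimura1982, §4 Thm. 4.2] at `n = 2`, `r = 1`): for
`g = hermTwo (p, w, q) > 0`, `t > 0`, `1 < re β`, `3 < re(α+β)`, with `q′ := q − |w|²/p = det g / p`:
`η₂(g, diag(t,0); α, β) = (π/p) · e^{−pt} · q′^{−(α+β−2)} Γ(α+β−2) · ∫₀^∞ e^{−pr} (r+2t)^{α−2} r^{β−2} dr`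
(§6 shear to `diag(p, q′)`, then §5). [Shimura1982, §4 Thm. 4.2, (4.10)–(4.12)] [Shimura1997, §18.4] -/
theorem etaTwo_rankOne_eq {p q : ℝ} {w : ℂ} (hp : 0 < p) (hpq : normSq w < p * q) {t : ℝ} (ht : 0 < t) {α β : ℂ} (hβ : 1 < β.re)
    (hαβ : 3 < (α + β).re) :
    etaTwo (hermTwo (p, w, q)) (hermTwo (t, 0, 0)) α β =
      (Real.pi : ℂ) / p * cexp (-((p * t : ℝ) : ℂ)) *
        ((1 / ((q - normSq w / p : ℝ) : ℂ)) ^ (α + β - 2) * Complex.Gamma (α + β - 2)) *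
        ∫ r in Ioi (0 : ℝ), cexp (-((p * r : ℝ) : ℂ)) * (((r + 2 * t : ℝ) : ℂ) ^ (α - 2) * ((r : ℝ) : ℂ) ^ (β - 2)) := by
  have hq' : 0 < q - normSq w / p := by
    rw [sub_pos, div_lt_iff₀ hp]
    linarith
  rw [etaTwo_eq_of_conj_fix (a := !![(1 : ℂ), -w / p; 0, 1]) (isHermitian_hermTwo _) (by rw [det_shear, norm_one])
      (shear_mul_rankOne_mul_conjTranspose _ t) (hermTwo (p, w, q)) α β,
    conjTranspose_shear_mul_mul p q w hp.ne', etaTwo_diag_rankOne_eq hp hq' ht hβ hαβ]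


end Summit.HodgeConjecture.HodgeConjecture.Cruxes.HLiu418.K2LiuHermTwoEtaRankOneReduction

end
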